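import Summits.Ventures.CertifiedManyBodySolver.Certificates.HubbardSquare_n7o8_stiffness_chordOneStation_ax10_boxes_A
import Summits.Ventures.CertifiedManyBodySolver.Observables.StiffnessApexTransportFermiSeaBoxes
import HarnessLib
import HarnessLib.Audit

/-!
# Ventures/CertifiedManyBodySolver — Certificates/HubbardSquare_n7o8_stiffness_chordOneStation_twins9o8_ax10_boxes_A.lean

HONEST FRAMING: the ELECTRON-DOPED `n = 9/8` particle–hole TWINS (`4 ∣ L`, `(t′, 7/8) ↦ (−t′, 9/8)`; `box_twin_nine_div_eight`,
`ObsStiffnessSeqCeilingAt.twin_nine_div_eight`) of the (N41) «A0′ LADDER + APEX CAPS + ⅞ CORNER WORDS ON THE NEW CRUX-ROW WINDOW [#795 ∣ #816], BY NAME» words of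
`Certificates/HubbardSquare_n7o8_stiffness_chordOneStation_ax10_boxes_A.lean` (hubbard-fast-reuse-2 g25; 1 twins in this file; same constants, mirrored hopping intervals). Dictionary class: one-sided stiffness CEILINGS, transport-only,
conditional on EXACTLY the premises of their 7/8 originals (registry rows #544 ∕ #568 and the T590 node BY NAME as used; cap: the (8,⅞,0) apex faces `hi₈₁₆ + A₈′t′` (t′ ≥ 0, K₂ ceiling node `hK2c`) ∕ `hi₈₁₆ + B₈t′` (t′ ≤ 0, K₂ floor node `hK`) BY NAME with window premises
from CERTIFIED #795 `h795` ∕ #816 `h816`).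
«other observable», Δε = 0; not registry rows; not a superconductivity or `T_c` verdict; NO summit statement is proved by this seat. Zero compute, no definition, no new claim
node, no `sorry`. Cell `pub/hubbard-fast` (D-0154 (1)(A)), seat `hubbard-fast-reuse-2` g25 (object (N41)).
References: E. H. Lieb, F. Y. Wu, Physica A 321 (2003) 1, §1 eq. (3) [LiebWuPhysicaA2003]; D. J. Scalapino, S. R. White, S.-C. Zhang, PRB 47 (1993) 7995, §II [ScalapinoWhiteZhang1993].
-/

noncomputable section

namespace Summit.Ventures.CertifiedManyBodySolver.Certificates

open Literature.MathematicalPhysics.QuantumLattice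
open Literature.MathematicalPhysics.QuantumLattice.ThermodynamicLimit
open Summit.Ventures.CertifiedManyBodySolver.Observables

/-- 9/8 twin of `n7o8_oblqCOax10MixBox_U29o4_15o2_tpm1o50_0_stiffnessWord_of`: the mirrored box `[29/4, 15/2] × [0, 1/50]` at `n = 9/8` (`4 ∣ L`), `ρ_s ≤ 0.3796792`. [cite: LiebWuPhysicaA2003, §1 eq. (3)] -/
theorem n9o8_oblqCOax10MixBox_U29o4_15o2_tpm1o50_0_twin_of (h590 : cert_r590_bs_GU7o2n7o8tpm3o10_w3_b4_R2_ob5p2_kry1_kry2c3rel_hanK7B4D4_KN4_PR20d4_uprime) (h568 : cert_r568_bs_GU2n7o8tp0_w3_b4_R2_ob5p2_kry1_kry2c3rel_eom8_hanK7B4D4_menulite_core_U2_focert_it3150) (hK : cert_a0_K2floor_EXT5LpA0n7o8tp0_j300552_up) (h795 : cert_r795_XL2a_GU8n7o8eom8_w3_b4_R2_ob5p2_kry1_kry2c3rel_menuE1_hanK9newD4S3ax8drop_core_focert_it4000) (h816 : cert_plaqseam_W6c112D3200FLIP_x01_allmk) :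
    ∀ U ∈ Set.Icc (29/4 : ℝ) (15/2), ∀ t ∈ Set.Icc (0 : ℝ) (1/50),
      ObsStiffnessSeqCeilingOnMultiples 4 t U (9 / 8) (474599/1250000) :=
  fun U hU t ht => box_twin_nine_div_eight (n7o8_oblqCOax10MixBox_U29o4_15o2_tpm1o50_0_stiffnessWord_of h590 h568 hK h795 h816) U hU t ⟨by norm_num; linarith [ht.1], by norm_num; linarith [ht.2]⟩

end Summit.Ventures.CertifiedManyBodySolver.Certificates

end
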